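import Literature.RingTheory.FormalGroups.FormalOModuleBudCocycle
import HarnessLib

/-!
# Buds of formal `𝒪`-module laws, VII: two buds that agree to order `m − 1` differ by a Drinfeld cocycle, and conversely
# ([Lazard 1955] §II Lemme 2–3, §III; [Drinfeld 1974] §1, proof of Prop. 1.4)

Topic `Literature/RingTheory/FormalGroups`; namespace `Literature.RingTheory.FormalGroups`.  One plumbing definition
(`lazardSeries m = C_m(X₀,X₁)` as a power series) + fully proved theorems; no named fact, no instance, no notation, no `sorry`.
Cell `hodgecm-mathlib`, P6 «MOD programme», sub-line P6d (power-series layer for `stub_L4B3cO`).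

* `IsOModuleBud.isBudRelation_of_sub` — let `(F, ρ)` be bud data and `(F′, ρ′)` an `m`-bud (`m ≥ 2`) with `F′ ≡ F`,
  `ρ′ ≡ ρ (mod deg m)`, and let `g : B → N` be `𝒪`-linear killing the degree-`m` coefficients of the defects of `(F, ρ)`; then
  the images of the degree-`m` coefficients of `(F′ − F, ρ′ − ρ)` satisfy the bud relations in `N`.  With `g = id` (when
  `(F, ρ)` is itself an `m`-bud): `IsOModuleBud.exists_isDrinfeldCocycle_of_sub` — TWO `m`-BUDS AGREEING TO ORDER `m − 1`
  DIFFER, in degree `m`, BY `(C_m • c, δ·X^m)` FOR A DRINFELD COCYCLE `(c, δ)`.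
* `IsOModuleBud.add_cocycle` — conversely, adding `(c·C_m(X₀,X₁), δ_a·X^m)` for a Drinfeld cocycle `(c, δ)` to an `m`-bud
  gives an `m`-bud.
-/

noncomputable section

namespace Literature.RingTheory.FormalGroups

open MvPowerSeries (HasSubst subst X order coeff)
open Finset Finsupp

universe u v w

variable {𝒪 : Type u} [CommRing 𝒪] {B : Type v} [CommRing B] [Algebra 𝒪 B]

/-! ## §1 Orders and degree-`m` coefficients -/

/-- `↑(m+1) ≤ G.order` from `↑m ≤ G.order` and the vanishing of all degree-`m` coefficients. [cite: Lazard1955, §I Lemme 1] -/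
theorem natCast_succ_le_order {τ : Type*} {m : ℕ} {G : MvPowerSeries τ B} (hG : (m : ℕ∞) ≤ G.order)
    (h : ∀ d : τ →₀ ℕ, d.degree = m → coeff d G = 0) : ((m + 1 : ℕ) : ℕ∞) ≤ G.order := by
  rw [natCast_le_order_iff] at hG ⊢
  intro d hd
  rcases Nat.lt_or_ge d.degree m with hlt | hge
  · exact hG d hlt
  · exact h d (by omega)

/-- Degree-`m` coefficients vanish when `↑(m+1) ≤ G.order`. [cite: Lazard1955, §I Lemme 1] -/
theorem coeff_eq_zero_of_succ_le_order {τ : Type*} {m : ℕ} {G : MvPowerSeries τ B} (hG : ((m + 1 : ℕ) : ℕ∞) ≤ G.order)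
    {d : τ →₀ ℕ} (hd : d.degree = m) : coeff d G = 0 :=
  (natCast_le_order_iff.1 hG) d (by omega)

/-- A three-variable exponent is `(d 0, d 1, d 2)`. [folklore] -/
private theorem fin3_eq (d : Fin 3 →₀ ℕ) : d = single 0 (d 0) + single 1 (d 1) + single 2 (d 2) := by
  ext i; fin_cases i <;> simp

/-- A two-variable exponent of degree `m` is `(d 0, m − d 0)`. [folklore] -/
private theorem fin2_eq {m : ℕ} {d : Fin 2 →₀ ℕ} (hd : d.degree = m) : d = single 0 (d 0) + single 1 (m - d 0) ∧ d 0 ≤ m := by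
  rw [degree_eq_sum, Fin.sum_univ_two] at hd
  refine ⟨Finsupp.ext fun i => ?_, by omega⟩
  fin_cases i
  · simp
  · simp; omega

/-- A one-variable exponent of degree `m` is `single () m`. [folklore] -/
private theorem unit_eq {m : ℕ} {d : Unit →₀ ℕ} (hd : d.degree = m) : d = single () m := by
  rw [degree_eq_sum, Fintype.sum_unique] at hd
  refine Finsupp.ext fun u => ?_
  obtain ⟨⟩ := u
  simpa using hd

section Orders

variable {m : ℕ} {Γ : MvPowerSeries (Fin 2) B}

/-- `assocVar Γ` has order `≥ m` when `Γ` has. [cite: Lazard1955, §II Lemme 2] -/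
theorem le_order_assocVar (hΓ : (m : ℕ∞) ≤ Γ.order) : (m : ℕ∞) ≤ (assocVar Γ).order := by
  rw [assocVar]
  refine natCast_le_order_sub (natCast_le_order_sub (natCast_le_order_add ?_ ?_) ?_) ?_ <;>
    exact le_order_subst_of_le hΓ fun i => by fin_cases i <;> simp

/-- `commDefect Γ` has order `≥ m` when `Γ` has. [cite: Lazard1955, §II Lemme 2] -/
theorem le_order_commDefect (hΓ : (m : ℕ∞) ≤ Γ.order) : (m : ℕ∞) ≤ (commDefect Γ).order := by
  rw [commDefect]
  exact natCast_le_order_sub hΓ (le_order_subst_of_le hΓ fun i => by fin_cases i <;> simp)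

/-- `homVar c Γ θ` has order `≥ m` when `Γ`, `θ` have. [cite: Drinfeld1974, §1 Prop. 1.4 (proof)] -/
theorem le_order_homVar (hΓ : (m : ℕ∞) ≤ Γ.order) {θ : PowerSeries B} (hθ : (m : ℕ∞) ≤ MvPowerSeries.order θ) (c : B) :
    (m : ℕ∞) ≤ (homVar c Γ θ).order := by
  rw [homVar]
  refine natCast_le_order_sub (natCast_le_order_sub (natCast_le_order_sub (natCast_le_order_add ?_ ?_) ?_) ?_) ?_
  · exact le_order_psubst_of_le hθ (by simp)
  · exact le_trans hΓ (MvPowerSeries.le_order_smul)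
  · exact le_order_subst_of_le hΓ fun i => by fin_cases i <;> simp
  · exact le_order_psubst_of_le hθ (MvPowerSeries.constantCoeff_X 0)
  · exact le_order_psubst_of_le hθ (MvPowerSeries.constantCoeff_X 1)

/-- `addVar` has order `≥ m` when `Γ`, `θ_a`, `θ_b`, `θ_{ab}` have. [cite: Drinfeld1974, §1 Prop. 1.4 (proof)] -/
theorem le_order_addVar (hΓ : (m : ℕ∞) ≤ Γ.order) {θa θb θab : PowerSeries B} (hθa : (m : ℕ∞) ≤ MvPowerSeries.order θa)
    (hθb : (m : ℕ∞) ≤ MvPowerSeries.order θb) (hθab : (m : ℕ∞) ≤ MvPowerSeries.order θab) (ca cb : B) :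
    (m : ℕ∞) ≤ MvPowerSeries.order (addVar ca cb Γ θa θb θab) := by
  rw [addVar]
  refine natCast_le_order_sub (natCast_le_order_sub (natCast_le_order_sub hθab hθa) hθb) ?_
  exact le_order_subst_of_le hΓ fun i => by fin_cases i <;> (change PowerSeries.constantCoeff (_ • PowerSeries.X) = 0; simp)

/-- `mulVar` has order `≥ m` when `θ_a`, `θ_b`, `θ_{ab}` have. [cite: Drinfeld1974, §1 Prop. 1.4 (proof)] -/
theorem le_order_mulVar {θa θb θab : PowerSeries B} (hθa : (m : ℕ∞) ≤ MvPowerSeries.order θa)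
    (hθb : (m : ℕ∞) ≤ MvPowerSeries.order θb) (hθab : (m : ℕ∞) ≤ MvPowerSeries.order θab) (ca cb : B) :
    (m : ℕ∞) ≤ MvPowerSeries.order (mulVar ca cb θa θb θab) := by
  rw [mulVar]
  refine natCast_le_order_sub (natCast_le_order_sub hθab (le_trans hθb MvPowerSeries.le_order_smul)) ?_
  exact le_order_psubst_of_le hθa (by change PowerSeries.constantCoeff (_ • PowerSeries.X) = 0; simp)

end Orders

/-! ## §2 Two buds agreeing to order `m − 1` -/

section Difference

variable {m : ℕ} {F F' : MvPowerSeries (Fin 2) B} {ρ ρ' : 𝒪 → PowerSeries B} {N : Type w} [AddCommGroup N] [Module 𝒪 N]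

/-- Generic step: if `Var ≡ D′ − D (mod deg m+1)`, `D′ ≡ 0 (mod deg m+1)` and `g` kills `[X^d] D` (`|d| = m`), then `g`
kills `[X^d] Var`. [cite: Lazard1955, §II Lemme 2] -/
private theorem map_coeff_var_eq_zero {τ : Type} (g : B →ₗ[𝒪] N) {D D' V : MvPowerSeries τ B} {d : τ →₀ ℕ}
    (hd : d.degree = m) (hvar : ((m + 1 : ℕ) : ℕ∞) ≤ (D' - D - V).order) (hD' : ((m + 1 : ℕ) : ℕ∞) ≤ D'.order)
    (hgD : g (coeff d D) = 0) : g (coeff d V) = 0 := by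
  have e : coeff d V = coeff d D' - coeff d (D' - D - V) - coeff d D := by simp only [map_sub]; ring
  rw [e, coeff_eq_zero_of_succ_le_order hD' hd, coeff_eq_zero_of_succ_le_order hvar hd, sub_zero, zero_sub, map_neg, hgD,
    neg_zero]

/-- **The degree-`m` relations of the difference of two buds.**  `(F, ρ)` bud data (a `1`-bud), `(F′, ρ′)` an `m`-bud
(`m ≥ 2`), `F′ ≡ F`, `ρ′ ≡ ρ (mod deg m)`; `g : B → N` `𝒪`-linear killing the degree-`m` coefficients of the defects of
`(F, ρ)`.  Then the `g`-images of the degree-`m` coefficients of `(F′ − F, ρ′ − ρ)` satisfy the bud relations.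
[cite: Lazard1955, §II Lemme 2] [cite: Drinfeld1974, §1 Prop. 1.4 (proof)] -/
theorem IsOModuleBud.isBudRelation_of_sub (hm : 2 ≤ m) (h : IsOModuleBud 𝒪 1 F ρ) (h' : IsOModuleBud 𝒪 m F' ρ')
    (hF : (m : ℕ∞) ≤ (F' - F).order) (hρ : ∀ a, (m : ℕ∞) ≤ MvPowerSeries.order (ρ' a - ρ a)) (g : B →ₗ[𝒪] N)
    (gA : ∀ d : Fin 3 →₀ ℕ, d.degree = m → g (coeff d (assocDefect F)) = 0)
    (gC : ∀ d : Fin 2 →₀ ℕ, d.degree = m → g (coeff d (commDefect F)) = 0)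
    (gH : ∀ (a : 𝒪) (d : Fin 2 →₀ ℕ), d.degree = m → g (coeff d (homDefect F (ρ a))) = 0)
    (gAdd : ∀ a b : 𝒪, g (PowerSeries.coeff m (addDefect F (ρ a) (ρ b) (ρ (a + b)))) = 0)
    (gMul : ∀ a b : 𝒪, g (PowerSeries.coeff m (mulDefect (ρ a) (ρ b) (ρ (a * b)))) = 0) :
    IsBudRelation 𝒪 m (fun j => g (degCoeff m (F' - F) j)) (fun a => g (PowerSeries.coeff m (ρ' a - ρ a))) := by
  have hF' : F + (F' - F) = F' := add_sub_cancel F F'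
  have hρ' : ∀ a, ρ a + (ρ' a - ρ a) = ρ' a := fun a => add_sub_cancel _ _
  have hdeg3 : ∀ i j k : ℕ, (single (0 : Fin 3) i + single 1 j + single 2 k).degree = i + j + k := fun i j k => by
    rw [map_add, map_add, degree_single, degree_single, degree_single]
  have hdeg2 : ∀ j : ℕ, j ≤ m → (single (0 : Fin 2) j + single 1 (m - j)).degree = m := fun j hj => by
    rw [map_add, degree_single, degree_single]; omega
  have hdeg1 : (single () m).degree = m := by rw [degree_single]
  have hcoeff : ∀ (V : PowerSeries B), MvPowerSeries.coeff (single () m) V = PowerSeries.coeff m V := fun V => by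
    rw [PowerSeries.coeff_def (s := single () m) (n := m) (by simp)]
  refine isBudRelation_of_coeff_var hF (fun a => hρ a) g (fun i j k hijk => ?_) (fun j hj => ?_) (fun a j hj => ?_)
    (fun a b => ?_) (fun a b => ?_)
  · have V := le_order_assocDefect_add_sub h.constantCoeff_F h.two_le_order_F hm hF
    rw [hF'] at V
    exact map_coeff_var_eq_zero g (d := single 0 i + single 1 j + single 2 k) (by rw [hdeg3, hijk]) V h'.assoc
      (gA _ (by rw [hdeg3, hijk]))
  · have V : ((m + 1 : ℕ) : ℕ∞) ≤ (commDefect F' - commDefect F - commDefect (F' - F)).order := by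
      rw [← hF', commDefect_add, add_sub_cancel_left, add_sub_cancel, sub_self, MvPowerSeries.order_zero]; exact le_top
    exact map_coeff_var_eq_zero g (hdeg2 j hj) V h'.comm (gC _ (hdeg2 j hj))
  · have V := le_order_homDefect_add_sub h.constantCoeff_F h.two_le_order_F (h.constantCoeff_ρ a) (h.two_le_order_ρ a) hm hF
      (hρ a)
    rw [hF', hρ'] at V
    exact map_coeff_var_eq_zero g (hdeg2 j hj) V (h'.hom a) (gH a _ (hdeg2 j hj))
  · have hg : g (MvPowerSeries.coeff (single () m) (addDefect F (ρ a) (ρ b) (ρ (a + b)))) = 0 := by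
      rw [hcoeff]; exact gAdd a b
    have V := le_order_addDefect_add_sub (φab := ρ (a + b)) (θab := ρ' (a + b) - ρ (a + b)) h.two_le_order_F
      (h.constantCoeff_ρ a) (h.constantCoeff_ρ b) (h.two_le_order_ρ a) (h.two_le_order_ρ b) hm hF (hρ a) (hρ b)
    rw [hF', hρ', hρ', hρ'] at V
    have := map_coeff_var_eq_zero g hdeg1 V (h'.add a b) hg
    rwa [hcoeff] at this
  · have hg : g (MvPowerSeries.coeff (single () m) (mulDefect (ρ a) (ρ b) (ρ (a * b)))) = 0 := by
      rw [hcoeff]; exact gMul a b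
    have V := le_order_mulDefect_add_sub (φab := ρ (a * b)) (θab := ρ' (a * b) - ρ (a * b)) (h.constantCoeff_ρ b)
      (h.two_le_order_ρ a) (h.two_le_order_ρ b) hm (hρ a) (hρ b)
    rw [hρ', hρ', hρ'] at V
    have := map_coeff_var_eq_zero g hdeg1 V (h'.mul a b) hg
    rwa [hcoeff] at this

/-- **Two `m`-buds agreeing to order `m − 1` differ in degree `m` by a Drinfeld cocycle** (`m ≥ 2`): there is `c : B` with
`[X₀^jX₁^{m−j}](F′ − F) = c_{m,j}·c` for all `j` and `(c, a ↦ [X^m](ρ′_a − ρ_a))` a Drinfeld cocycle over `B`.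
[cite: Lazard1955, §II Lemme 3] [cite: Drinfeld1974, §1 Prop. 1.4 (proof)] -/
theorem IsOModuleBud.exists_isDrinfeldCocycle_of_sub (hm : 2 ≤ m) (h : IsOModuleBud 𝒪 m F ρ) (h' : IsOModuleBud 𝒪 m F' ρ')
    (hF : (m : ℕ∞) ≤ (F' - F).order) (hρ : ∀ a, (m : ℕ∞) ≤ MvPowerSeries.order (ρ' a - ρ a)) :
    ∃ c : B, (∀ j, degCoeff m (F' - F) j = cocycleCoeff m j • c) ∧
      IsDrinfeldCocycle m c (fun a => PowerSeries.coeff m (ρ' a - ρ a)) := by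
  have hdeg1 : (single () m).degree = m := by rw [degree_single]
  have hrel := IsOModuleBud.isBudRelation_of_sub hm (h.mono (by omega)) h' hF hρ (LinearMap.id : B →ₗ[𝒪] B)
    (fun d hd => by simpa using coeff_eq_zero_of_succ_le_order h.assoc hd)
    (fun d hd => by simpa using coeff_eq_zero_of_succ_le_order h.comm hd)
    (fun a d hd => by simpa using coeff_eq_zero_of_succ_le_order (h.hom a) hd)
    (fun a b => by
      rw [LinearMap.id_apply, PowerSeries.coeff_def (s := single () m) (n := m) (by simp)]
      exact coeff_eq_zero_of_succ_le_order (h.add a b) hdeg1)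
    (fun a b => by
      rw [LinearMap.id_apply, PowerSeries.coeff_def (s := single () m) (n := m) (by simp)]
      exact coeff_eq_zero_of_succ_le_order (h.mul a b) hdeg1)
  simpa using hrel.exists_isDrinfeldCocycle hm

end Difference

end Literature.RingTheory.FormalGroups
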